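import Summits.QuantumFields.BalabanUV.Beta.SymSliceProjectorRules
import Summits.QuantumFields.BalabanUV.Beta.AveragingWardRootedStencils

/-!
# `BalabanUV.Beta.SymSliceProjectorDiagComm` — binder row D1, SYMMETRISED literal «JsB12Sym», hW class: THE SLICE PROJECTOR `symEc` COMMUTES WITH EVERY
# DIAGONAL CONTACT WHOSE FIELD SYMBOL IS BLOCK-CONSTANT — in particular with the block pure-gauge generator `diagK (ξ • Σ_{v∈box} legInd ρ (N•y + v))`
# of the resolvent-generic Ward induction `WardLocusInduction.hSd_all` (its hypothesis `hEX` at `E := symEc N`; OFFER (i) of LOCATED QUESTION X-an2-55)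

HONEST FRAMING (cell charter, verbatim): «discharging BetaPertH makes Balaban's UV stability UNCONDITIONAL — a real constructive-QFT result; it is
NOT the continuum limit and NOT the Clay problem.»  HONEST DEPENDENCY: continuum YM on T⁴ ⇐ BetaPertH ∧ nine spine estimates (0/9 proved);
BetaPertH ⇐ (D1) ∧ (D4) ∧ CAP+tail; G-an2-4 gates asym, D1 and NE2/3/4.
DERIVED cell leaf (β sub-cell, BINDER-OWNERS row D1 OWNER `b2b-balaban-beta-an2`, gen 27; STAGED AS AN OFFER — filed only on a request line or a referee's word
under the coordinator's ruling e34b3e0c (0)).  No statement of Bałaban's papers, no `[cite:]`, no `Prop` fact, no `def`.  Discharges NO binder: it is ONE of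
the three open inputs of the (Sd)-letter route for `JsB12Sym` recorded in X-an2-55 (the other two — the border letter (V-d) and the straight step-Hessian
dictionary — are where the slice-exchange row bites and are NOT touched here).  NOT D1, NOT `BetaPertH`, NOT continuum, NOT Clay.
WHAT ([folklore]): §1 **`comp_symEc_diagK_comm_of_blockConst`**: if `g x (inl α) = g x′ (inl β)` whenever `blk N x = blk N x′`, then
`symEc N ∘ diagK g = diagK g ∘ symEc N` (`symEc`'s interior field rows couple only bonds of ONE block, its face-crossing rows and its multiplier block are
diagonal — `SymSliceProjectorKernel.symEc_inl_inl_of_int ∕ _of_not_int ∕ symEc_inr_inr` + `BorderedHessian.comp_diagK_left∕right`).  §2 `sum_box_legInd_inl`: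
on field legs `Σ_{v∈box} legInd ρ (N•y + v) z (inl α) = [blk N z = y]` (block indicator, leg-independent); **`comp_symEc_blockGen_comm`**: the instance for the
block generator, every `ρ`, `ξ`, `y`, `N ≥ 1`.  Provenance: β sub-cell, unit beta-an2 gen 27, 2026-08-21 (v1, staged); over `SymSliceProjector{Kernel,Rules}`,
`DiagonalContact`, `AveragingWardRootedStencils`, `WardLocusCubic.zsmul_add_toSite_eq_iff`-type bookkeeping BY NAME; no existing file touched.
-/

open Finset
open scoped BigOperators
open Literature.Probability.LatticeModels (TorusSite Torus.proj Torus.proj_apply)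
open Literature.MathematicalPhysics.QuantumFieldTheory
open Literature.MathematicalPhysics.QuantumFieldTheory.Balaban1983to89
open Literature.MathematicalPhysics.QuantumFieldTheory.Balaban1983to89.Beta
open ExpKernelCalculus (MKer comp)
open AffineAveraging (box toSite)
open AveragingContours (blk blk_block off off_mem_box blk_add_off)
open OneStepResolventKernel (Fib)
open Summit.QuantumFields.BalabanUV.Beta.TameKernelCalculus
open Summit.QuantumFields.BalabanUV.Beta.BorderedHessian (diagK diagK_apply comp_diagK_left comp_diagK_right)
open Summit.QuantumFields.BalabanUV.Beta.SymSliceProjectorKernel (symEc IsIntBond symEc_inl_inl_of_int symEc_inl_inl_of_not_int symEc_inl_inr symEc_inr_inl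
  symEc_inr_inr)
open Summit.QuantumFields.BalabanUV.Beta.AveragingWardRootedStencils (legInd legInd_inl)

namespace Summit.QuantumFields.BalabanUV.Beta.SymSliceProjectorDiagComm

noncomputable section

variable {d : ℕ} {N : ℕ}

/-! ## §1 Diagonal contacts with block-constant field symbol commute with `symEc` -/

/-- [folklore] **`symEc N ∘ diagK g = diagK g ∘ symEc N` WHENEVER THE FIELD SYMBOL OF `g` IS BLOCK-CONSTANT** (no condition on the multiplier symbol). -/
theorem comp_symEc_diagK_comm_of_blockConst {g : (Fin (d + 1) → ℤ) → Fib d → ℝ}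
    (hg : ∀ (x x' : Fin (d + 1) → ℤ) (α β : Fin (d + 1)), blk N x = blk N x' → g x (Sum.inl α) = g x' (Sum.inl β)) :
    comp (symEc N) (diagK g) = comp (diagK g) (symEc (d := d) N) := by
  funext x z a b
  rw [comp_diagK_right, comp_diagK_left]
  rcases a with α | m <;> rcases b with β | m'
  · by_cases h : IsIntBond N α x ∧ IsIntBond N β z
    · rw [symEc_inl_inl_of_int h.1 h.2]
      by_cases hb : blk N x = blk N z
      · rw [if_pos hb, hg x z α β hb, mul_comm]
      · rw [if_neg hb, zero_mul, mul_zero]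
    · rw [symEc_inl_inl_of_not_int h]
      by_cases he : x = z ∧ α = β
      · obtain ⟨rfl, rfl⟩ := he
        rw [mul_comm]
      · rw [if_neg he, zero_mul, mul_zero]
  · rw [symEc_inl_inr, zero_mul, mul_zero]
  · rw [symEc_inr_inl, zero_mul, mul_zero]
  · rw [symEc_inr_inr]
    by_cases he : x = z ∧ m = m' ∧ Torus.proj N x = 0
    · obtain ⟨rfl, rfl, -⟩ := he
      rw [mul_comm]
    · rw [if_neg he, zero_mul, mul_zero]

/-! ## §2 The block pure-gauge generator -/

/-- [folklore] A fine site lies in block `y` with offset `v` iff `blk z = y` and `v = off z` (`N ≥ 1`). -/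
theorem eq_zsmul_add_toSite_iff (hN : 1 ≤ N) {z y : Fin (d + 1) → ℤ} {v : Fin (d + 1) → ℕ} (hv : v ∈ box (d + 1) N) :
    z = (N : ℤ) • y + toSite v ↔ blk N z = y ∧ v = off N z := by
  constructor
  · intro h
    have hb : blk N z = y := by rw [h]; exact blk_block y hv
    refine ⟨hb, ?_⟩
    have h1 := blk_add_off hN z
    rw [hb] at h1
    -- `N•y + toSite (off z) = z = N•y + toSite v`
    have h2 : toSite (off N z) = toSite v := by
      have := h1.trans h
      exact add_left_cancel this
    funext i
    have := congrFun h2 i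
    simp only [toSite, Nat.cast_inj] at this
    exact this.symm
  · rintro ⟨hb, hv'⟩
    rw [hv', ← hb]
    exact (blk_add_off hN z).symm

/-- [folklore] **ON FIELD LEGS THE BLOCK GENERATOR IS THE BLOCK INDICATOR**: `Σ_{v∈box} legInd ρ (N•y + v) z (inl α) = [blk N z = y]`. -/
theorem sum_box_legInd_inl (hN : 1 ≤ N) (ρ y z : Fin (d + 1) → ℤ) (α : Fin (d + 1)) :
    ∑ v ∈ box (d + 1) N, legInd ρ ((N : ℤ) • y + toSite v) z (Sum.inl α) = if blk N z = y then 1 else 0 := by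
  classical
  simp only [legInd_inl]
  by_cases hy : blk N z = y
  · rw [if_pos hy, Finset.sum_eq_single (off N z)]
    · rw [if_pos ((eq_zsmul_add_toSite_iff hN (off_mem_box hN z)).2 ⟨hy, rfl⟩)]
    · intro v hv hne
      rw [if_neg]
      intro h
      exact hne ((eq_zsmul_add_toSite_iff hN hv).1 h).2
    · intro h
      exact absurd (off_mem_box hN z) h
  · rw [if_neg hy]
    refine Finset.sum_eq_zero fun v hv => ?_
    rw [if_neg]
    intro h
    exact hy ((eq_zsmul_add_toSite_iff hN hv).1 h).1

/-- [folklore] **`symEc` COMMUTES WITH THE BLOCK PURE-GAUGE GENERATOR** `diagK (ξ • Σ_{v∈box} legInd ρ (N•y + v))` — the hypothesis `hEX` of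
`WardLocusInduction.hSd_all` ∕ `hSd_step` at `E := symEc N`, every root `ρ`, scale `ξ`, coarse label `y`. -/
theorem comp_symEc_blockGen_comm (hN : 1 ≤ N) (ρ : Fin (d + 1) → ℤ) (ξ : ℝ) (y : Fin (d + 1) → ℤ) :
    comp (symEc N) (diagK (ξ • ∑ v ∈ box (d + 1) N, legInd ρ ((N : ℤ) • y + toSite v))) =
      comp (diagK (ξ • ∑ v ∈ box (d + 1) N, legInd ρ ((N : ℤ) • y + toSite v))) (symEc (d := d) N) := by
  refine comp_symEc_diagK_comm_of_blockConst fun x x' α β hxx' => ?_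
  simp only [Pi.smul_apply, Finset.sum_apply, smul_eq_mul]
  rw [sum_box_legInd_inl hN, sum_box_legInd_inl hN, hxx']

end

end Summit.QuantumFields.BalabanUV.Beta.SymSliceProjectorDiagComm
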